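import Summits.QuantumFields.YangMills.Theorems.ColdStartUniversalityLatticeLangevinLocalPoincare
import Summits.QuantumFields.YangMills.Theorems.ColdStartUniversalityLatticeLangevinGradientBoundFlowOfRep
import HarnessLib

/-!
# Route `ColdStartUniversality` (fixed-cut-off package, Bakry–Émery side, GRADIENT half): the REVERSE LOCAL POINCARÉ INEQUALITY
# `((e^(ct) − 1)/c)·Γ^A(P_t F) ≤ P_t(F²) − (P_t F)²` — the SZZ semigroup turns bounded observables into Lipschitz ones, uniformly in `L`

Helper file (seat `ym-line-csu-p1`, g29; `--supports stmt-QuantumFields-24809`).  Second consequence of the gradient bound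
`wilson_carre_transition_le_of_hessBound` for the SU(2) lattice Langevin (SZZ) dynamics at a fixed cut-off (BGL Thm 4.7.2 (iii)), in its
INTEGRATED (dual) form against a non-negative test function `H = h∘coords`:
  ★★★ `integral_mul_variance_transition_ge_of_hessBound`:  for `K₀ < 2`, `c = 2 − K₀`, `C⁵` compactly supported `f, h`, `H ≥ 0`, and a `C³`
  compactly supported representative `g` of `κ_t(f∘coords)`:
  `((e^(ct) − 1)/c) · ∫ H·Γ^A(g) dμ_(β') ≤ ∫ H·κ_t(F²) dμ_(β') − ∫ H·(κ_t F)² dμ_(β')`.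
PROOF: as in `…LocalPoincareFlow`, `Ψ(s) = ∫ κ_sH·(κ_(t−s)F)² dμ` has `Ψ'(s) = ∫ κ_sH·Γ^A(κ_(t−s)F) dμ = ∫ H·κ_s(Γ^A(κ_(t−s)F)) dμ`, now bounded
BELOW by `e^(cs)·∫ H·Γ^A(κ_tF) dμ` (gradient bound for `κ_s` acting on `κ_(t−s)F`, Chapman–Kolmogorov `κ_sκ_(t−s) = κ_t`).  The pointwise form
(`Γ^A(κ_tF)(x) ≤ (c/(e^(ct)−1))·(κ_t(F²)(x) − (κ_tF(x))²) ≤ (c/(e^(ct)−1))·sup F²`: L∞ → Lipschitz smoothing) follows in the sequel.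
THEOREMS ONLY, no definition, no sorry.  HONEST FRAMING: fixed cut-off; the route's scaling `β'_K → ∞` leaves the window `K₀ < 2`;
nothing K-uniform; no crux, rung or summit statement is proved; the Yang–Mills mass gap is NOT proved.
-/

set_option autoImplicit false

noncomputable section

namespace Summit.QuantumFields.YangMills.Theorems.ColdStartUniversality

open MeasureTheory ProbabilityTheory Matrix Complex Finset Filter Set Metric
open scoped ComplexConjugate BigOperators Matrix NNReal ENNReal Topology
open Literature.Probability.Process Literature.MathematicalPhysics.QuantumFieldTheory
open Literature.MathematicalPhysics.QuantumLattice (fundamentalRep fundamentalLatticeRep continuous_fundamentalRep fundamentalRep_apply)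

variable {L : ℕ} [NeZero L]

/-- ★★★ **Reverse local Poincaré inequality for the SZZ semigroup, integrated form.**  Under the frame Hessian bound `K₀ < 2`
(`c = 2 − K₀`): for `C⁵` compactly supported `f, h` with `h∘coords ≥ 0`, any realising Markov kernel family `κ`, `t ≥ 0` and any `C³`
compactly supported `g` with `κ_t(f∘coords) = g∘coords`,
`((e^(ct) − 1)/c)·∫ (h∘coords)·Γ^A(g) dμ_(β') ≤ ∫ (h∘coords)·κ_t((f∘coords)²) dμ_(β') − ∫ (h∘coords)·(κ_t(f∘coords))² dμ_(β')`.
[cite: BakryGentilLedoux2014, Thm 4.7.2 (iii) (reverse local Poincaré inequality under CD(ρ,∞))] -/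
theorem integral_mul_variance_transition_ge_of_hessBound (L : ℕ) [NeZero L] (β' K₀ : ℝ) (hK : K₀ < 2)
    (hHess : (∀ (V : (GaugeConfig 3 L (Matrix.specialUnitaryGroup (Fin 2) ℂ))) (Λ : (Edge 3 L × Fin (fundamentalLatticeRep 2).N × Fin (fundamentalLatticeRep 2).N × Bool → ℝ) →L[ℝ] ℝ),
      ∑ n : Edge 3 L × NoiseIdx (fundamentalLatticeRep 2).N, ∑ m : Edge 3 L × NoiseIdx (fundamentalLatticeRep 2).N,
        Λ ((fun q : Edge 3 L × Fin (fundamentalLatticeRep 2).N × Fin (fundamentalLatticeRep 2).N × Bool => if n.1 = q.1 then (fun z : ℂ => if q.2.2.2 then z.im else z.re) (((Real.sqrt 2 : ℂ) • ((fundamentalLatticeRep 2).lieProj (noiseDir n.2) * (fun (ee : Edge 3 L) => Matrix.of fun (i j : Fin (fundamentalLatticeRep 2).N) => (((fun (V : GaugeConfig 3 L (Matrix.specialUnitaryGroup (Fin 2) ℂ)) (q : Edge 3 L × Fin (fundamentalLatticeRep 2).N × Fin (fundamentalLatticeRep 2).N × Bool) => (fun z : ℂ => if q.2.2.2 then z.im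 else z.re) ((fundamentalRep (Fin 2) (V q.1) : Matrix (Fin 2) (Fin 2) ℂ) q.2.1 q.2.2.1)) V (ee, i, j, false) : ℝ) : ℂ) + (((fun (V : GaugeConfig 3 L (Matrix.specialUnitaryGroup (Fin 2) ℂ)) (q : Edge 3 L × Fin (fundamentalLatticeRep 2).N × Fin (fundamentalLatticeRep 2).N × Bool) => (fun z : ℂ => if q.2.2.2 then z.im else z.re) ((fundamentalRep (Fin 2) (V q.1) : Matrix (Fin 2) (Fin 2) ℂ) q.2.1 q.2.2.1)) V (ee, i, j, true) : ℝ) : ℂ) * Complex.I) q.1)) q.2.1 q.2.2.1) else 0)) * Λ ((fun q : Edge 3 L × Fin (fundamentalLatticeRep 2).N × Fin (fundamentalLatticeRep 2).N × Bool => if m.1 = q.1 then (fun z : ℂ => if q.2.2.2 then z.im else z.re) (((Real.sqrt 2 : ℂ) • ((fundamentalLatticeRep 2).lieProj (noiseDir m.2) * (fun (ee : Edge 3 L) => Matrix.of fun (i j : Fin (fundamentalLatticeRep 2).N) => (((fun (V : GaugeConfig 3 L (Matrix.specialUnitaryGroup (Fin 2) ℂ)) (q : Edge 3 L × Fin (fundamentalLatticeRep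 2).N × Fin (fundamentalLatticeRep 2).N × Bool) => (fun z : ℂ => if q.2.2.2 then z.im else z.re) ((fundamentalRep (Fin 2) (V q.1) : Matrix (Fin 2) (Fin 2) ℂ) q.2.1 q.2.2.1)) V (ee, i, j, false) : ℝ) : ℂ) + (((fun (V : GaugeConfig 3 L (Matrix.specialUnitaryGroup (Fin 2) ℂ)) (q : Edge 3 L × Fin (fundamentalLatticeRep 2).N × Fin (fundamentalLatticeRep 2).N × Bool) => (fun z : ℂ => if q.2.2.2 then z.im else z.re) ((fundamentalRep (Fin 2) (V q.1) : Matrix (Fin 2) (Fin 2) ℂ) q.2.1 q.2.2.1)) V (ee, i, j, true) : ℝ) : ℂ) * Complex.I) q.1)) q.2.1 q.2.2.1) else 0)) *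
          fderiv ℝ (fun z : (Edge 3 L × Fin (fundamentalLatticeRep 2).N × Fin (fundamentalLatticeRep 2).N × Bool → ℝ) => fderiv ℝ (fun y : (Edge 3 L × Fin (fundamentalLatticeRep 2).N × Fin (fundamentalLatticeRep 2).N × Bool → ℝ) => β' * ∑ p : Plaquette 3 L, (rootedLoop (fun (ee : Edge 3 L) (i j : Fin (fundamentalLatticeRep 2).N) => ((y (ee, i, j, false) : ℝ) : ℂ) + ((y (ee, i, j, true) : ℝ) : ℂ) * Complex.I) (p.1, p.2.1.1) p.2.1.2 false).trace.re) z (fun q : Edge 3 L × Fin (fundamentalLatticeRep 2).N × Fin (fundamentalLatticeRep 2).N × Bool => if m.1 = q.1 then (fun z : ℂ => if q.2.2.2 then z.im else z.re) (((Real.sqrt 2 : ℂ) • ((fundamentalLatticeRep 2).lieProj (noiseDir m.2) * (fun (ee : Edge 3 L) => Matrix.of fun (i j : Fin (fundamentalLatticeRep 2).N) => ((z (ee, i, j, false) : ℝ) : ℂ) + ((z (ee, i, j, true) : ℝ) : ℂ) * Complex.I) q.1)) q.2.1 q.2.2.1) else 0)) ((fun (V : GaugeConfig 3 L (Matrix.specialUnitaryGroup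 (Fin 2) ℂ)) (q : Edge 3 L × Fin (fundamentalLatticeRep 2).N × Fin (fundamentalLatticeRep 2).N × Bool) => (fun z : ℂ => if q.2.2.2 then z.im else z.re) ((fundamentalRep (Fin 2) (V q.1) : Matrix (Fin 2) (Fin 2) ℂ) q.2.1 q.2.2.1)) V) (fun q : Edge 3 L × Fin (fundamentalLatticeRep 2).N × Fin (fundamentalLatticeRep 2).N × Bool => if n.1 = q.1 then (fun z : ℂ => if q.2.2.2 then z.im else z.re) (((Real.sqrt 2 : ℂ) • ((fundamentalLatticeRep 2).lieProj (noiseDir n.2) * (fun (ee : Edge 3 L) => Matrix.of fun (i j : Fin (fundamentalLatticeRep 2).N) => (((fun (V : GaugeConfig 3 L (Matrix.specialUnitaryGroup (Fin 2) ℂ)) (q : Edge 3 L × Fin (fundamentalLatticeRep 2).N × Fin (fundamentalLatticeRep 2).N × Bool) => (fun z : ℂ => if q.2.2.2 then z.im else z.re) ((fundamentalRep (Fin 2) (V q.1) : Matrix (Fin 2) (Fin 2) ℂ) q.2.1 q.2.2.1)) V (ee, i, j, false) : ℝ) : ℂ) + (((fun (V : GaugeConfig 3 L (Matrix.specialUnitaryGroup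 (Fin 2) ℂ)) (q : Edge 3 L × Fin (fundamentalLatticeRep 2).N × Fin (fundamentalLatticeRep 2).N × Bool) => (fun z : ℂ => if q.2.2.2 then z.im else z.re) ((fundamentalRep (Fin 2) (V q.1) : Matrix (Fin 2) (Fin 2) ℂ) q.2.1 q.2.2.1)) V (ee, i, j, true) : ℝ) : ℂ) * Complex.I) q.1)) q.2.1 q.2.2.1) else 0)
        ≤ K₀ * ∑ n : Edge 3 L × NoiseIdx (fundamentalLatticeRep 2).N, (Λ (fun q : Edge 3 L × Fin (fundamentalLatticeRep 2).N × Fin (fundamentalLatticeRep 2).N × Bool => if n.1 = q.1 then (fun z : ℂ => if q.2.2.2 then z.im else z.re) (((Real.sqrt 2 : ℂ) • ((fundamentalLatticeRep 2).lieProj (noiseDir n.2) * (fun (ee : Edge 3 L) => Matrix.of fun (i j : Fin (fundamentalLatticeRep 2).N) => (((fun (V : GaugeConfig 3 L (Matrix.specialUnitaryGroup (Fin 2) ℂ)) (q : Edge 3 L × Fin (fundamentalLatticeRep 2).N × Fin (fundamentalLatticeRep 2).N × Bool) => (fun z : ℂ => if q.2.2.2 then z.im else z.re) ((fundamentalRep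 (Fin 2) (V q.1) : Matrix (Fin 2) (Fin 2) ℂ) q.2.1 q.2.2.1)) V (ee, i, j, false) : ℝ) : ℂ) + (((fun (V : GaugeConfig 3 L (Matrix.specialUnitaryGroup (Fin 2) ℂ)) (q : Edge 3 L × Fin (fundamentalLatticeRep 2).N × Fin (fundamentalLatticeRep 2).N × Bool) => (fun z : ℂ => if q.2.2.2 then z.im else z.re) ((fundamentalRep (Fin 2) (V q.1) : Matrix (Fin 2) (Fin 2) ℂ) q.2.1 q.2.2.1)) V (ee, i, j, true) : ℝ) : ℂ) * Complex.I) q.1)) q.2.1 q.2.2.1) else 0)) ^ 2))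
    (κ : ℝ≥0 → Kernel (GaugeConfig 3 L (Matrix.specialUnitaryGroup (Fin 2) ℂ))
      (GaugeConfig 3 L (Matrix.specialUnitaryGroup (Fin 2) ℂ))) [∀ t, IsMarkovKernel (κ t)]
    (hreal : ∀ (t : ℝ≥0) (x : GaugeConfig 3 L (Matrix.specialUnitaryGroup (Fin 2) ℂ))
        (Ω : Type) [MeasurableSpace Ω] (P : Measure Ω) [IsProbabilityMeasure P]
        (W : ℝ≥0 → Ω → (Edge 3 L × NoiseIdx 2 → ℝ)) (hW : IsFlatBrownian W P)
        (U : ℝ≥0 → Ω → GaugeConfig 3 L (Matrix.specialUnitaryGroup (Fin 2) ℂ)),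
        (∀ ω, U 0 ω = x) →
        (latticeLangevinDynamics (fundamentalLatticeRep 2) β').IsSolution (fundamentalRep (Fin 2))
          hW.natFiltration P W U →
        κ t x = P.map (U t))
    {f : (Edge 3 L × Fin 2 × Fin 2 × Bool → ℝ) → ℝ} (hf : ContDiff ℝ 5 f) (hfc : HasCompactSupport f)
    {h : (Edge 3 L × Fin 2 × Fin 2 × Bool → ℝ) → ℝ} (hh : ContDiff ℝ 5 h) (hhc : HasCompactSupport h) (t : ℝ≥0)
    {g : (Edge 3 L × Fin 2 × Fin 2 × Bool → ℝ) → ℝ} (hg : ContDiff ℝ 3 g) (hgc : HasCompactSupport g) :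
    let coords : GaugeConfig 3 L (Matrix.specialUnitaryGroup (Fin 2) ℂ) → (Edge 3 L × Fin 2 × Fin 2 × Bool → ℝ) :=
      fun V q => (fun z : ℂ => if q.2.2.2 then z.im else z.re)
        ((fundamentalRep (Fin 2) (V q.1) : Matrix (Fin 2) (Fin 2) ℂ) q.2.1 q.2.2.1)
    let A : GaugeConfig 3 L (Matrix.specialUnitaryGroup (Fin 2) ℂ) → (Edge 3 L × Fin 2 × Fin 2 × Bool) →
        (Edge 3 L × Fin 2 × Fin 2 × Bool) → ℝ := fun V i j =>
      ∑ n : Edge 3 L × NoiseIdx 2,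
        (if n.1 = i.1 then (fun z : ℂ => if i.2.2.2 then z.im else z.re)
          ((latticeLangevinDynamics (fundamentalLatticeRep 2) β').noise
            (matrixConfig (fundamentalRep (Fin 2)) V) i.1 n.2 i.2.1 i.2.2.1) else 0) *
        (if n.1 = j.1 then (fun z : ℂ => if j.2.2.2 then z.im else z.re)
          ((latticeLangevinDynamics (fundamentalLatticeRep 2) β').noise
            (matrixConfig (fundamentalRep (Fin 2)) V) j.1 n.2 j.2.1 j.2.2.1) else 0)
    (∀ x, 0 ≤ h (coords x)) → (∀ x, ∫ y, f (coords y) ∂(κ t x) = g (coords x)) →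
    (Real.exp ((2 - K₀) * (t : ℝ)) - 1) / (2 - K₀) * ∫ x, h (coords x) * (∑ i : Edge 3 L × Fin 2 × Fin 2 × Bool, ∑ j : Edge 3 L × Fin 2 × Fin 2 × Bool, fderiv ℝ g (coords x) (Pi.single i 1) * fderiv ℝ g (coords x) (Pi.single j 1) * A x i j) ∂(wilsonMeasure (d := 3) (L := L) (fundamentalRep (Fin 2)) β') ≤
      ∫ x, h (coords x) * (∫ y, f (coords y) * f (coords y) ∂(κ t x)) ∂(wilsonMeasure (d := 3) (L := L) (fundamentalRep (Fin 2)) β') -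
        ∫ x, h (coords x) * (∫ y, f (coords y) ∂(κ t x)) ^ 2 ∂(wilsonMeasure (d := 3) (L := L) (fundamentalRep (Fin 2)) β') := by
  intro coords A hh0 hgrep
  classical
  set gen : ((Edge 3 L × Fin 2 × Fin 2 × Bool → ℝ) → ℝ) → (GaugeConfig 3 L (Matrix.specialUnitaryGroup (Fin 2) ℂ)) → ℝ := fun φ V =>
      (∑ i : Edge 3 L × Fin 2 × Fin 2 × Bool, fderiv ℝ φ (coords V) (Pi.single i 1) *
          (fun z : ℂ => if i.2.2.2 then z.im else z.re)
            ((latticeLangevinDynamics (fundamentalLatticeRep 2) β').drift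
              (matrixConfig (fundamentalRep (Fin 2)) V) i.1 i.2.1 i.2.2.1) +
      1 / 2 * ∑ i : Edge 3 L × Fin 2 × Fin 2 × Bool, ∑ j : Edge 3 L × Fin 2 × Fin 2 × Bool,
        fderiv ℝ (fun z => fderiv ℝ φ z (Pi.single i 1)) (coords V) (Pi.single j 1) * A V i j) with hgen_def
  haveI := secondCountableTopology_su2
  haveI := borelSpace_config L
  set μ : Measure (GaugeConfig 3 L (Matrix.specialUnitaryGroup (Fin 2) ℂ)) := (wilsonMeasure (d := 3) (L := L) (fundamentalRep (Fin 2)) β') with hμ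
  haveI : IsProbabilityMeasure μ :=
    isProbabilityMeasure_wilsonMeasure (d := 3) (L := L) (fundamentalRep (Fin 2)) (continuous_fundamentalRep (Fin 2)) β'
  have hco : Continuous coords := continuous_coords (L := L)
  have hInt : ∀ {Φ : (GaugeConfig 3 L (Matrix.specialUnitaryGroup (Fin 2) ℂ)) → ℝ}, Continuous Φ → Integrable Φ μ := fun hΦ => integrable_of_continuous_of_compactSpace hΦ μ
  have hκ0 : κ 0 = Kernel.id := transitionKernel_zero_eq_id (L := L) (β' := β') κ hreal
  set cK : ℝ := 2 - K₀ with hcK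
  have hc0 : 0 < cK := by rw [hcK]; linarith
  have hf3 : ContDiff ℝ 3 f := hf.of_le (by norm_num)
  have hf2 : ContDiff ℝ 2 f := hf.of_le (by norm_num)
  have hh3 : ContDiff ℝ 3 h := hh.of_le (by norm_num)
  have hh2 : ContDiff ℝ 2 h := hh.of_le (by norm_num)
  -- §0 a `C³` compactly supported ambient representative `a` of `𝓛f`
  obtain ⟨s, c, hs, -, -, -, hCas⟩ := exists_noiseFrame L
  set s2 : (Edge 3 L × NoiseIdx (fundamentalLatticeRep 2).N) → ((Edge 3 L × Fin 2 × Fin 2 × Bool → ℝ) →L[ℝ] (Edge 3 L × Fin 2 × Fin 2 × Bool → ℝ)) := s with hs2def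
  set ψ : (Edge 3 L × Fin 2 × Fin 2 × Bool → ℝ) → ℝ := (fun y : (Edge 3 L × Fin 2 × Fin 2 × Bool → ℝ) => β' * ∑ p : Plaquette 3 L, (rootedLoop (fun (ee : Edge 3 L) (i j : Fin 2) => ((y (ee, i, j, false) : ℝ) : ℂ) + ((y (ee, i, j, true) : ℝ) : ℂ) * Complex.I) (p.1, p.2.1.1) p.2.1.2 false).trace.re) with hψ
  have hψ4 : ContDiff ℝ 4 ψ := contDiff_psiHat (d := 3) (L := L) (N := (fundamentalLatticeRep 2).N) β'
  have hD : ∀ φ : (Edge 3 L × Fin 2 × Fin 2 × Bool → ℝ) → ℝ, ContDiff ℝ 2 φ → ∀ V : (GaugeConfig 3 L (Matrix.specialUnitaryGroup (Fin 2) ℂ)), gen φ V = 1 / 2 * ∑ n : Edge 3 L × NoiseIdx (fundamentalLatticeRep 2).N,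
      (fderiv ℝ (fun w => fderiv ℝ φ w (s2 n w)) (coords V) (s2 n (coords V)) +
        fderiv ℝ ψ (coords V) (s2 n (coords V)) * fderiv ℝ φ (coords V) (s2 n (coords V))) :=
    fun φ hφ V => generator_eq_half_frameGen L β' s hs hCas φ hφ V
  obtain ⟨a, ha, hac, haf⟩ : ∃ a : (Edge 3 L × Fin 2 × Fin 2 × Bool → ℝ) → ℝ, ContDiff ℝ 3 a ∧ HasCompactSupport a ∧ ∀ x : (GaugeConfig 3 L (Matrix.specialUnitaryGroup (Fin 2) ℂ)), a (coords x) = gen f x := by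
    set a₀ : (Edge 3 L × Fin 2 × Fin 2 × Bool → ℝ) → ℝ := fun z => 1 / 2 * ∑ n : Edge 3 L × NoiseIdx (fundamentalLatticeRep 2).N,
      (fderiv ℝ (fun w => fderiv ℝ f w (s2 n w)) z (s2 n z) + fderiv ℝ ψ z (s2 n z) * fderiv ℝ f z (s2 n z)) with ha₀
    have ha₀C : ContDiff ℝ 3 a₀ := contDiff_const.mul (contDiff_frameGen (k := 3) hf hψ4 s2)
    obtain ⟨a, ha, hac, hanear⟩ := exists_contDiff_hasCompactSupport_eqOn (n := 3) ha₀C 1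
    refine ⟨a, ha, hac, fun x => ?_⟩
    have h1 : a (coords x) = a₀ (coords x) := (hanear _ (norm_coords_le_one x)).self_of_nhds
    rw [h1, hD f hf2 x]
  -- §1 Dynkin-class representatives of `κ_s F`, `κ_s(a∘coords)`, `κ_s H`
  have hBKf := fun s : ℝ≥0 => transitionKernel_backwardKolmogorov (L := L) β' κ hreal hf3 hfc s
  have hBKa := fun s : ℝ≥0 => transitionKernel_backwardKolmogorov (L := L) β' κ hreal ha hac s
  have hBKh := fun s : ℝ≥0 => transitionKernel_backwardKolmogorov (L := L) β' κ hreal hh3 hhc s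
  choose gF hgF hgFc hgFrep hgFcomm _ using hBKf
  choose gA hgA hgAc hgArep hgAcomm _ using hBKa
  choose gH hgH hgHc hgHrep hgHcomm _ using hBKh
  have hgFrep' : ∀ (s : ℝ≥0) (x : (GaugeConfig 3 L (Matrix.specialUnitaryGroup (Fin 2) ℂ))), ∫ y, f (coords y) ∂(κ s x) = gF s (coords x) := fun s x => hgFrep s x
  have hgArep' : ∀ (s : ℝ≥0) (x : (GaugeConfig 3 L (Matrix.specialUnitaryGroup (Fin 2) ℂ))), ∫ y, a (coords y) ∂(κ s x) = gA s (coords x) := fun s x => hgArep s x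
  have hgHrep' : ∀ (s : ℝ≥0) (x : (GaugeConfig 3 L (Matrix.specialUnitaryGroup (Fin 2) ℂ))), ∫ y, h (coords y) ∂(κ s x) = gH s (coords x) := fun s x => hgHrep s x
  have hgFcomm' : ∀ (s : ℝ≥0) (x : (GaugeConfig 3 L (Matrix.specialUnitaryGroup (Fin 2) ℂ))), gen (gF s) x = ∫ y, gen f y ∂(κ s x) := fun s x => hgFcomm s x
  have hgHcomm' : ∀ (s : ℝ≥0) (x : (GaugeConfig 3 L (Matrix.specialUnitaryGroup (Fin 2) ℂ))), gen (gH s) x = ∫ y, gen h y ∂(κ s x) := fun s x => hgHcomm s x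
  -- §2 kernel actions `PF = κF`, `PA = κ(𝓛F)`, `PH = κH`, `PB = κ(𝓛H)`
  have cF : Continuous fun y : (GaugeConfig 3 L (Matrix.specialUnitaryGroup (Fin 2) ℂ)) => f (coords y) := hf.continuous.comp hco
  have cFF : Continuous fun y : (GaugeConfig 3 L (Matrix.specialUnitaryGroup (Fin 2) ℂ)) => f (coords y) * f (coords y) := cF.mul cF
  have cAf : Continuous fun y : (GaugeConfig 3 L (Matrix.specialUnitaryGroup (Fin 2) ℂ)) => a (coords y) := ha.continuous.comp hco
  have cH : Continuous fun y : (GaugeConfig 3 L (Matrix.specialUnitaryGroup (Fin 2) ℂ)) => h (coords y) := hh.continuous.comp hco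
  have cBh : Continuous (gen h) := continuous_generator (L := L) β' hh2
  have hgenf : gen f = fun y => a (coords y) := funext fun y => (haf y).symm
  obtain ⟨PF, hPF⟩ : ∃ PF : ℝ → (GaugeConfig 3 L (Matrix.specialUnitaryGroup (Fin 2) ℂ)) → ℝ, PF = fun τ x => ∫ y, f (coords y) ∂(κ τ.toNNReal x) := ⟨_, rfl⟩
  obtain ⟨PA, hPA⟩ : ∃ PA : ℝ → (GaugeConfig 3 L (Matrix.specialUnitaryGroup (Fin 2) ℂ)) → ℝ, PA = fun τ x => ∫ y, a (coords y) ∂(κ τ.toNNReal x) := ⟨_, rfl⟩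
  obtain ⟨PH, hPH⟩ : ∃ PH : ℝ → (GaugeConfig 3 L (Matrix.specialUnitaryGroup (Fin 2) ℂ)) → ℝ, PH = fun τ x => ∫ y, h (coords y) ∂(κ τ.toNNReal x) := ⟨_, rfl⟩
  obtain ⟨PB, hPB⟩ : ∃ PB : ℝ → (GaugeConfig 3 L (Matrix.specialUnitaryGroup (Fin 2) ℂ)) → ℝ, PB = fun τ x => ∫ y, gen h y ∂(κ τ.toNNReal x) := ⟨_, rfl⟩
  have hcx : ∀ {Φ : (GaugeConfig 3 L (Matrix.specialUnitaryGroup (Fin 2) ℂ)) → ℝ}, Continuous Φ → ∀ τ : ℝ, Continuous fun x => ∫ y, Φ y ∂(κ τ.toNNReal x) :=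
    fun hΦ τ => continuous_integral_transitionKernel L β' κ hreal τ.toNNReal hΦ
  have hct : ∀ {Φ : (GaugeConfig 3 L (Matrix.specialUnitaryGroup (Fin 2) ℂ)) → ℝ}, Continuous Φ → ∀ x : (GaugeConfig 3 L (Matrix.specialUnitaryGroup (Fin 2) ℂ)), Continuous fun τ : ℝ => ∫ y, Φ y ∂(κ τ.toNNReal x) :=
    fun hΦ x => (continuous_transitionKernel_action (L := L) β' κ hreal hΦ).comp (continuous_real_toNNReal.prodMk continuous_const)
  have hbd : ∀ {Φ : (GaugeConfig 3 L (Matrix.specialUnitaryGroup (Fin 2) ℂ)) → ℝ}, Continuous Φ → ∃ M : ℝ, ∀ (τ : ℝ) (x : (GaugeConfig 3 L (Matrix.specialUnitaryGroup (Fin 2) ℂ))), |∫ y, Φ y ∂(κ τ.toNNReal x)| ≤ M := by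
    intro Φ hΦ
    obtain ⟨M, hM⟩ : ∃ M, ∀ y : (GaugeConfig 3 L (Matrix.specialUnitaryGroup (Fin 2) ℂ)), |Φ y| ≤ M := by
      obtain ⟨M, hM⟩ := isCompact_univ.exists_bound_of_continuousOn hΦ.continuousOn
      exact ⟨M, fun y => by simpa [Real.norm_eq_abs] using hM y (Set.mem_univ y)⟩
    refine ⟨M, fun τ x => ?_⟩
    haveI : IsProbabilityMeasure (κ τ.toNNReal x) := IsMarkovKernel.isProbabilityMeasure x
    refine (abs_integral_le_integral_abs).trans ?_
    calc ∫ y, |Φ y| ∂(κ τ.toNNReal x) ≤ ∫ _y, M ∂(κ τ.toNNReal x) :=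
          integral_mono (integrable_of_continuous_of_compactSpace (continuous_abs.comp hΦ) _) (integrable_const _) fun y => hM y
      _ = M := by simp
  have h0 : ∀ {Φ : (GaugeConfig 3 L (Matrix.specialUnitaryGroup (Fin 2) ℂ)) → ℝ}, Continuous Φ → ∀ x : (GaugeConfig 3 L (Matrix.specialUnitaryGroup (Fin 2) ℂ)), ∫ y, Φ y ∂(κ (0 : ℝ).toNNReal x) = Φ x := by
    intro Φ hΦ x
    rw [Real.toNNReal_zero, hκ0, Kernel.id_apply, integral_dirac' _ _ hΦ.measurable.stronglyMeasurable]
  have hDer : ∀ {φ : (Edge 3 L × Fin 2 × Fin 2 × Bool → ℝ) → ℝ}, ContDiff ℝ 3 φ → HasCompactSupport φ → ∀ (x : (GaugeConfig 3 L (Matrix.specialUnitaryGroup (Fin 2) ℂ))) {τ : ℝ}, 0 < τ →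
      HasDerivAt (fun τ : ℝ => ∫ y, φ (coords y) ∂(κ τ.toNNReal x)) (∫ y, gen φ y ∂(κ τ.toNNReal x)) τ := by
    intro φ hφ hφc x τ hτ
    have hDf := fun {σ : ℝ} (hσ : (0 : ℝ) ≤ σ) => transitionKernel_dynkin (L := L) β' κ hreal hφ hφc x hσ
    have hgc : Continuous (gen φ) := continuous_generator (L := L) β' (hφ.of_le (by norm_num))
    have hac : Continuous fun r : ℝ => ∫ y, gen φ y ∂(κ r.toNNReal x) := hct hgc x
    have hder : HasDerivAt (fun σ : ℝ => φ (coords x) + ∫ r in (0 : ℝ)..σ, ∫ y, gen φ y ∂(κ r.toNNReal x))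
        (∫ y, gen φ y ∂(κ τ.toNNReal x)) τ :=
      ((intervalIntegral.integral_hasDerivAt_right (hac.intervalIntegrable _ _)
        (hac.stronglyMeasurableAtFilter _ _) hac.continuousAt)).const_add _
    refine hder.congr_of_eventuallyEq ?_
    filter_upwards [Ioi_mem_nhds hτ] with σ hσ
    exact hDf (le_of_lt hσ)
  obtain ⟨MF, hMF⟩ := hbd cF
  obtain ⟨MA, hMA⟩ := hbd cAf
  obtain ⟨MH, hMH⟩ := hbd cH
  obtain ⟨MB, hMB⟩ := hbd cBh
  have bF : ∀ τ x, |PF τ x| ≤ MF := fun τ x => by rw [hPF]; exact hMF τ x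
  have bA : ∀ τ x, |PA τ x| ≤ MA := fun τ x => by rw [hPA]; exact hMA τ x
  have bH : ∀ τ x, |PH τ x| ≤ MH := fun τ x => by rw [hPH]; exact hMH τ x
  have bB : ∀ τ x, |PB τ x| ≤ MB := fun τ x => by rw [hPB]; exact hMB τ x
  have cxF : ∀ τ, Continuous fun x => PF τ x := fun τ => by rw [hPF]; exact hcx cF τ
  have cxA : ∀ τ, Continuous fun x => PA τ x := fun τ => by rw [hPA]; exact hcx cAf τ
  have cxH : ∀ τ, Continuous fun x => PH τ x := fun τ => by rw [hPH]; exact hcx cH τ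
  have cxB : ∀ τ, Continuous fun x => PB τ x := fun τ => by rw [hPB]; exact hcx cBh τ
  have ctF : ∀ x, Continuous fun τ => PF τ x := fun x => by rw [hPF]; exact hct cF x
  have ctA : ∀ x, Continuous fun τ => PA τ x := fun x => by rw [hPA]; exact hct cAf x
  have ctH : ∀ x, Continuous fun τ => PH τ x := fun x => by rw [hPH]; exact hct cH x
  have ctB : ∀ x, Continuous fun τ => PB τ x := fun x => by rw [hPB]; exact hct cBh x
  have dF : ∀ x {τ : ℝ}, 0 < τ → HasDerivAt (fun τ => PF τ x) (PA τ x) τ := fun x τ hτ => by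
    have hd := hDer hf3 hfc x hτ
    rw [hgenf] at hd
    rw [hPF, hPA]; exact hd
  have dH : ∀ x {τ : ℝ}, 0 < τ → HasDerivAt (fun τ => PH τ x) (PB τ x) τ := fun x τ hτ => by
    rw [hPH, hPB]; exact hDer hh3 hhc x hτ
  -- §3 `Ψ(s) = ∫ κ_sH·(κ_(T−s)F)²`, its derivative `Λ`, and the bound `M`
  set T : ℝ := (t : ℝ) with hT
  have hT0 : 0 ≤ T := t.coe_nonneg
  have hTt : T.toNNReal = t := by rw [hT, Real.toNNReal_coe]
  obtain ⟨Ψ, hΨ⟩ : ∃ Ψ : ℝ → ℝ, Ψ = fun σ => ∫ x, PH σ x * (PF (T - σ) x * PF (T - σ) x) ∂μ := ⟨_, rfl⟩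
  obtain ⟨Λ, hΛ⟩ : ∃ Λ : ℝ → ℝ, Λ = fun σ => ∫ x, (PB σ x * (PF (T - σ) x * PF (T - σ) x) - 2 * (PH σ x * (PF (T - σ) x * PA (T - σ) x))) ∂μ := ⟨_, rfl⟩
  set M : ℝ := ∫ x, h (coords x) * (∑ i : Edge 3 L × Fin 2 × Fin 2 × Bool, ∑ j : Edge 3 L × Fin 2 × Fin 2 × Bool, fderiv ℝ g (coords x) (Pi.single i 1) * fderiv ℝ g (coords x) (Pi.single j 1) * A x i j) ∂μ with hM
  have hΨc : Continuous Ψ := by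
    rw [hΨ]
    refine continuous_of_dominated (bound := fun _ => MH * (MF * MF)) (fun σ => ?_) (fun σ => ?_)
      (integrable_const _) (ae_of_all _ fun x => ?_)
    · exact ((cxH σ).mul ((cxF _).mul (cxF _))).aestronglyMeasurable
    · exact ae_of_all _ fun x => by rw [Real.norm_eq_abs]; exact abs_mul_mul_le (bH σ x) (bF (T - σ) x) (bF (T - σ) x)
    · have cs : Continuous fun σ : ℝ => T - σ := continuous_const.sub continuous_id
      exact (ctH x).mul (((ctF x).comp cs).mul ((ctF x).comp cs))
  have hΨder : ∀ σ ∈ Ioo 0 T, HasDerivAt Ψ (Λ σ) σ := by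
    intro σ hσ
    obtain ⟨hσ0, hσT⟩ := hσ
    rw [hΨ, hΛ]
    have hs : Ioo (σ / 2) ((σ + T) / 2) ∈ 𝓝 σ := Ioo_mem_nhds (by linarith) (by linarith)
    refine (hasDerivAt_integral_of_dominated_loc_of_deriv_le (μ := μ) (x₀ := σ)
      (F := fun σ x => PH σ x * (PF (T - σ) x * PF (T - σ) x))
      (F' := fun σ x => PB σ x * (PF (T - σ) x * PF (T - σ) x) - 2 * (PH σ x * (PF (T - σ) x * PA (T - σ) x)))
      (bound := fun _ => MB * (MF * MF) + 2 * (MH * (MF * MA))) hs ?_ ?_ ?_ ?_ (integrable_const _) ?_).2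
    · exact Filter.Eventually.of_forall fun σ' => ((cxH σ').mul ((cxF _).mul (cxF _))).aestronglyMeasurable
    · exact hInt ((cxH σ).mul ((cxF _).mul (cxF _)))
    · exact (((cxB σ).mul ((cxF _).mul (cxF _))).sub (continuous_const.mul ((cxH σ).mul ((cxF _).mul (cxA _))))).aestronglyMeasurable
    · refine ae_of_all _ fun x σ' _ => ?_
      rw [Real.norm_eq_abs]
      refine (abs_sub _ _).trans (add_le_add (abs_mul_mul_le (bB σ' x) (bF (T - σ') x) (bF (T - σ') x)) ?_)
      rw [abs_mul, show |(2 : ℝ)| = 2 by norm_num]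
      exact mul_le_mul_of_nonneg_left (abs_mul_mul_le (bH σ' x) (bF (T - σ') x) (bA (T - σ') x)) (by norm_num)
    · refine ae_of_all _ fun x σ' hσ' => ?_
      obtain ⟨hσ'1, hσ'2⟩ := hσ'
      have hσ'0 : 0 < σ' := by linarith
      have hTσ' : 0 < T - σ' := by linarith
      have eH := dH x hσ'0
      have eF : HasDerivAt (fun σ => PF (T - σ) x) (-(PA (T - σ') x)) σ' := by
        have hc := HasDerivAt.comp σ' (dF x hTσ') ((hasDerivAt_id σ').const_sub T)
        exact hc.congr_deriv (by ring)
      have hall := eH.mul (eF.mul eF)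
      show HasDerivAt (fun σ => PH σ x * (PF (T - σ) x * PF (T - σ) x))
        (PB σ' x * (PF (T - σ') x * PF (T - σ') x) - 2 * (PH σ' x * (PF (T - σ') x * PA (T - σ') x))) σ'
      refine hall.congr_deriv ?_
      show PB σ' x * (PF (T - σ') x * PF (T - σ') x) + PH σ' x * (-(PA (T - σ') x) * PF (T - σ') x + PF (T - σ') x * -(PA (T - σ') x)) = _
      ring
  -- §4 the key bound `Λ(s) ≥ e^(cs)·M` on `(0, T)`: the integrated gradient bound for `κ_(s₁)` acting on the Dynkin-class function
  -- `u = gF s₂` (generator representative `gA s₂`), whose `κ_(s₁)`-image is `κ_T F = g` by Chapman–Kolmogorov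
  have hkey : ∀ σ ∈ Ioo 0 T, Real.exp (cK * σ) * M ≤ Λ σ := by
    intro σ hσ
    obtain ⟨hσ0, hσT⟩ := hσ
    set s₁ : ℝ≥0 := σ.toNNReal with hs₁
    set s₂ : ℝ≥0 := (T - σ).toNNReal with hs₂
    have hs₁R : ((s₁ : ℝ≥0) : ℝ) = σ := by rw [hs₁, Real.coe_toNNReal _ hσ0.le]
    have hs12 : s₁ + s₂ = t := by
      apply NNReal.eq
      rw [NNReal.coe_add, hs₁, hs₂, Real.coe_toNNReal _ hσ0.le, Real.coe_toNNReal _ (by linarith), hT]; ring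
    have eH : ∀ x, PH σ x = gH s₁ (coords x) := fun x => by rw [hPH]; exact hgHrep' s₁ x
    have eB : ∀ x, PB σ x = gen (gH s₁) x := fun x => by rw [hPB, hgHcomm' s₁ x]
    have eF : ∀ x, PF (T - σ) x = gF s₂ (coords x) := fun x => by rw [hPF]; exact hgFrep' s₂ x
    have eA : ∀ x, PA (T - σ) x = gA s₂ (coords x) := fun x => by rw [hPA]; exact hgArep' s₂ x
    have eAA : ∀ x, gA s₂ (coords x) = gen (gF s₂) x := fun x => by
      rw [← hgArep' s₂ x, hgFcomm' s₂ x]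
      exact integral_congr_ae (ae_of_all _ fun y => haf y)
    have hval : ∫ x, (gen (gH s₁) x * (gF s₂ (coords x) * gF s₂ (coords x)) - 2 * (gH s₁ (coords x) * (gF s₂ (coords x) * gA s₂ (coords x)))) ∂μ =
        ∫ x, gH s₁ (coords x) * (∑ i : Edge 3 L × Fin 2 × Fin 2 × Bool, ∑ j : Edge 3 L × Fin 2 × Fin 2 × Bool, fderiv ℝ (gF s₂) (coords x) (Pi.single i 1) * fderiv ℝ (gF s₂) (coords x) (Pi.single j 1) * A x i j) ∂μ :=
      flow_value_eq_integral_mul_carre L β' (hgH s₁) (hgHc s₁) (hgF s₂) (hgFc s₂) (hgA s₂) eAA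
    have hΛσ : Λ σ = ∫ x, gH s₁ (coords x) * (∑ i : Edge 3 L × Fin 2 × Fin 2 × Bool, ∑ j : Edge 3 L × Fin 2 × Fin 2 × Bool, fderiv ℝ (gF s₂) (coords x) (Pi.single i 1) * fderiv ℝ (gF s₂) (coords x) (Pi.single j 1) * A x i j) ∂μ := by
      rw [hΛ, ← hval]
      exact integral_congr_ae (ae_of_all _ fun x => by simp only [eB x, eH x, eF x, eA x])
    -- Chapman–Kolmogorov: `κ_(s₁)(gF s₂ ∘ coords) = κ_t F = g ∘ coords`
    have hCK : ∀ x : (GaugeConfig 3 L (Matrix.specialUnitaryGroup (Fin 2) ℂ)), ∫ y, gF s₂ (coords y) ∂(κ s₁ x) = g (coords x) := by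
      intro x
      rw [← hgrep x, ← hs12, chapmanKolmogorov_szz β' κ hreal s₁ s₂]
      haveI : IsProbabilityMeasure ((κ s₂ ∘ₖ κ s₁) x) := by rw [← chapmanKolmogorov_szz β' κ hreal s₁ s₂]; infer_instance
      rw [Kernel.integral_comp (cF.integrable_of_hasCompactSupport (HasCompactSupport.of_compactSpace _))]
      exact integral_congr_ae (ae_of_all _ fun z => (hgFrep' s₂ z).symm)
    have hG1 : Real.exp ((2 - K₀) * ((s₁ : ℝ≥0) : ℝ)) * ∫ x, h (coords x) * (∑ i : Edge 3 L × Fin 2 × Fin 2 × Bool, ∑ j : Edge 3 L × Fin 2 × Fin 2 × Bool, fderiv ℝ g (coords x) (Pi.single i 1) * fderiv ℝ g (coords x) (Pi.single j 1) * A x i j) ∂μ ≤ ∫ x, h (coords x) * (∫ y, (∑ i : Edge 3 L × Fin 2 × Fin 2 × Bool, ∑ j : Edge 3 L × Fin 2 × Fin 2 × Bool, fderiv ℝ (gF s₂) (coords y) (Pi.single i 1) * fderiv ℝ (gF s₂) (coords y) (Pi.single j 1) * A y i j) ∂(κ s₁ x)) ∂μ :=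
      integral_mul_carre_transition_le_of_generatorRep L β' K₀ hHess κ hreal (hgF s₂) (hgFc s₂) (hgA s₂) (hgAc s₂) hh hhc s₁ hg hgc eAA hh0 hCK
    rw [hs₁R] at hG1
    have cΓu : Continuous fun x : (GaugeConfig 3 L (Matrix.specialUnitaryGroup (Fin 2) ℂ)) => (∑ i : Edge 3 L × Fin 2 × Fin 2 × Bool, ∑ j : Edge 3 L × Fin 2 × Fin 2 × Bool, fderiv ℝ (gF s₂) (coords x) (Pi.single i 1) * fderiv ℝ (gF s₂) (coords x) (Pi.single j 1) * A x i j) := by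
      have hu2 : ContDiff ℝ 2 (gF s₂) := (hgF s₂).of_le (by norm_num)
      have cu : Continuous fun y : (GaugeConfig 3 L (Matrix.specialUnitaryGroup (Fin 2) ℂ)) => gF s₂ (coords y) := (hgF s₂).continuous.comp hco
      have hleib : ∀ x : (GaugeConfig 3 L (Matrix.specialUnitaryGroup (Fin 2) ℂ)), gen (fun z => gF s₂ z * gF s₂ z) x = gF s₂ (coords x) * gen (gF s₂) x + gF s₂ (coords x) * gen (gF s₂) x + (∑ i : Edge 3 L × Fin 2 × Fin 2 × Bool, ∑ j : Edge 3 L × Fin 2 × Fin 2 × Bool, fderiv ℝ (gF s₂) (coords x) (Pi.single i 1) * fderiv ℝ (gF s₂) (coords x) (Pi.single j 1) * A x i j) :=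
        fun x => generator_mul_coords L β' hu2 hu2 x
      have e : (fun x : (GaugeConfig 3 L (Matrix.specialUnitaryGroup (Fin 2) ℂ)) => (∑ i : Edge 3 L × Fin 2 × Fin 2 × Bool, ∑ j : Edge 3 L × Fin 2 × Fin 2 × Bool, fderiv ℝ (gF s₂) (coords x) (Pi.single i 1) * fderiv ℝ (gF s₂) (coords x) (Pi.single j 1) * A x i j)) = fun x => gen (fun z => gF s₂ z * gF s₂ z) x - (gF s₂ (coords x) * gen (gF s₂) x + gF s₂ (coords x) * gen (gF s₂) x) := by
        funext x; rw [hleib x]; ring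
      rw [e]
      exact (continuous_generator (L := L) β' (((hgF s₂).mul (hgF s₂)).of_le (by norm_num))).sub
        ((cu.mul (continuous_generator (L := L) β' hu2)).add (cu.mul (continuous_generator (L := L) β' hu2)))
    -- symmetry of `κ_(s₁)`: `∫ κ_(s₁)H · Γ^A(u) dμ = ∫ H · κ_(s₁)Γ^A(u) dμ`
    have hsym : ∫ x, gH s₁ (coords x) * (∑ i : Edge 3 L × Fin 2 × Fin 2 × Bool, ∑ j : Edge 3 L × Fin 2 × Fin 2 × Bool, fderiv ℝ (gF s₂) (coords x) (Pi.single i 1) * fderiv ℝ (gF s₂) (coords x) (Pi.single j 1) * A x i j) ∂μ = ∫ x, h (coords x) * (∫ y, (∑ i : Edge 3 L × Fin 2 × Fin 2 × Bool, ∑ j : Edge 3 L × Fin 2 × Fin 2 × Bool, fderiv ℝ (gF s₂) (coords y) (Pi.single i 1) * fderiv ℝ (gF s₂) (coords y) (Pi.single j 1) * A y i j) ∂(κ s₁ x)) ∂μ := by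
      calc ∫ x, gH s₁ (coords x) * (∑ i : Edge 3 L × Fin 2 × Fin 2 × Bool, ∑ j : Edge 3 L × Fin 2 × Fin 2 × Bool, fderiv ℝ (gF s₂) (coords x) (Pi.single i 1) * fderiv ℝ (gF s₂) (coords x) (Pi.single j 1) * A x i j) ∂μ = ∫ x, (∑ i : Edge 3 L × Fin 2 × Fin 2 × Bool, ∑ j : Edge 3 L × Fin 2 × Fin 2 × Bool, fderiv ℝ (gF s₂) (coords x) (Pi.single i 1) * fderiv ℝ (gF s₂) (coords x) (Pi.single j 1) * A x i j) * (∫ y, h (coords y) ∂(κ s₁ x)) ∂μ :=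
            integral_congr_ae (ae_of_all _ fun x => by
              show gH s₁ (coords x) * (∑ i : Edge 3 L × Fin 2 × Fin 2 × Bool, ∑ j : Edge 3 L × Fin 2 × Fin 2 × Bool, fderiv ℝ (gF s₂) (coords x) (Pi.single i 1) * fderiv ℝ (gF s₂) (coords x) (Pi.single j 1) * A x i j) = (∑ i : Edge 3 L × Fin 2 × Fin 2 × Bool, ∑ j : Edge 3 L × Fin 2 × Fin 2 × Bool, fderiv ℝ (gF s₂) (coords x) (Pi.single i 1) * fderiv ℝ (gF s₂) (coords x) (Pi.single j 1) * A x i j) * ∫ y, h (coords y) ∂(κ s₁ x)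
              rw [← hgHrep' s₁ x]; exact mul_comm _ _)
        _ = ∫ x, h (coords x) * (∫ y, (∑ i : Edge 3 L × Fin 2 × Fin 2 × Bool, ∑ j : Edge 3 L × Fin 2 × Fin 2 × Bool, fderiv ℝ (gF s₂) (coords y) (Pi.single i 1) * fderiv ℝ (gF s₂) (coords y) (Pi.single j 1) * A y i j) ∂(κ s₁ x)) ∂μ := integral_mul_transition_symm_su2 L β' κ hreal s₁ cΓu cH
    rw [hΛσ, hsym]
    exact hG1
  -- §5 `Θ(s) = Ψ(s) − (M/c)·e^(cs)` is non-decreasing on `[0, T]`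
  have hmono : MonotoneOn (fun σ => Ψ σ - M / cK * Real.exp (cK * σ)) (Icc 0 T) := by
    have hΘc : ContinuousOn (fun σ => Ψ σ - M / cK * Real.exp (cK * σ)) (Icc 0 T) :=
      (hΨc.sub (continuous_const.mul (Real.continuous_exp.comp (continuous_const.mul continuous_id)))).continuousOn
    have hΘd : ∀ σ ∈ Ioo 0 T, HasDerivAt (fun σ => Ψ σ - M / cK * Real.exp (cK * σ))
        (Λ σ - M / cK * (Real.exp (cK * σ) * (cK * 1))) σ := fun σ hσ =>
      (hΨder σ hσ).sub (((hasDerivAt_id' σ).const_mul cK).exp.const_mul _)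
    refine monotoneOn_of_deriv_nonneg (convex_Icc 0 T) hΘc (fun σ hσ => ?_) (fun σ hσ => ?_)
    · rw [interior_Icc] at hσ
      exact (hΘd σ hσ).differentiableAt.differentiableWithinAt
    · rw [interior_Icc] at hσ
      rw [(hΘd σ hσ).deriv]
      have h := hkey σ hσ
      have hcK0 : cK ≠ 0 := hc0.ne'
      have e : M / cK * (Real.exp (cK * σ) * (cK * 1)) = Real.exp (cK * σ) * M := by
        rw [mul_one, mul_comm (Real.exp _) cK, ← mul_assoc, div_mul_cancel₀ M hcK0, mul_comm]
      rw [e]; linarith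
  have hΘ := hmono (left_mem_Icc.2 hT0) (right_mem_Icc.2 hT0) hT0
  simp only [mul_zero, Real.exp_zero, mul_one] at hΘ
  -- §6 the endpoints `Ψ(T) = ∫ H·κ_t(F²)`, `Ψ(0) = ∫ H·(κ_t F)²`
  have hΨT : Ψ T = ∫ x, h (coords x) * (∫ y, f (coords y) * f (coords y) ∂(κ t x)) ∂μ := by
    have eF : ∀ x, PF (T - T) x = f (coords x) := fun x => by rw [hPF, sub_self]; exact h0 cF x
    have eH : ∀ x, PH T x = ∫ y, h (coords y) ∂(κ t x) := fun x => by rw [hPH]; show ∫ y, h (coords y) ∂(κ T.toNNReal x) = _; rw [hTt]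
    rw [hΨ]
    calc (fun σ => ∫ x, PH σ x * (PF (T - σ) x * PF (T - σ) x) ∂μ) T = ∫ x, (∫ y, h (coords y) ∂(κ t x)) * (f (coords x) * f (coords x)) ∂μ :=
          integral_congr_ae (ae_of_all _ fun x => by simp only [eF x, eH x])
      _ = ∫ x, (f (coords x) * f (coords x)) * (∫ y, h (coords y) ∂(κ t x)) ∂μ := integral_congr_ae (ae_of_all _ fun x => mul_comm _ _)
      _ = ∫ x, h (coords x) * (∫ y, f (coords y) * f (coords y) ∂(κ t x)) ∂μ := (integral_mul_transition_symm_su2 L β' κ hreal t cH cFF).symm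
  have hΨ0 : Ψ 0 = ∫ x, h (coords x) * (∫ y, f (coords y) ∂(κ t x)) ^ 2 ∂μ := by
    have eF : ∀ x, PF T x = ∫ y, f (coords y) ∂(κ t x) := fun x => by rw [hPF]; show ∫ y, f (coords y) ∂(κ T.toNNReal x) = _; rw [hTt]
    have eH : ∀ x, PH 0 x = h (coords x) := fun x => by rw [hPH]; exact h0 cH x
    rw [hΨ]
    exact integral_congr_ae (ae_of_all _ fun x => by simp only [sub_zero, eF x, eH x, sq])
  rw [← hΨT, ← hΨ0]
  have e2 : (Real.exp (cK * (t : ℝ)) - 1) / cK * M = M / cK * Real.exp (cK * T) - M / cK := by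
    rw [hT]; ring
  rw [e2]
  linarith [hΘ]

end Summit.QuantumFields.YangMills.Theorems.ColdStartUniversality
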